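import Summits.ResolutionOfSingularities.ResolutionOfSingularities.Theses.Valuative
import Summits.ResolutionOfSingularities.ResolutionOfSingularities.Theses.CyclicCovers
import Summits.ResolutionOfSingularities.ResolutionOfSingularities.Theorems.RegularBlowupsDesingularization
import Summits.ResolutionOfSingularities.ResolutionOfSingularities.Theorems.ValuativePatchingRelEmbeddedTransformSelf
import Literature.AlgebraicGeometry.Resolution.ProperModelsPatchingOfResolution
import Literature.AlgebraicGeometry.Resolution.ZariskiPatchingProperModels
import Literature.AlgebraicGeometry.Resolution.ProjectiveBirationalBlowupProofs
import Literature.AlgebraicGeometry.Resolution.EmbeddedResolutionExcellentSurfaces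
import Literature.AlgebraicGeometry.Resolution.QuasiProjectiveReduction
import Literature.AlgebraicGeometry.Motives.ProjectiveSpaceCoordinateEmbedding
import Literature.AlgebraicGeometry.Motives.VarietiesDimensionProofs
import HarnessLib.Audit
import HarnessLib

/-!
# Crux `PatchingRel` (stmt-ResolutionOfSingularities-0642), line `Ideator5Sketch` (card
# `bad-stratum-induction`): the line's Axiom-3 hypothesis `EmbResCodimTwo p` alone implies
# `ResolutionInChar p` — stub S1 `BadStratumPatching` closed, the line collapses onto stub S3

The line (crux-ideate round 2, ideator 5; skeleton `Cruxes/PatchingRel/Lines/Ideator5Sketch.lean`)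
composes Zariski's programme `resolutionInChar_of_properTwoModelPatching_of_relLU` with
`BadStratumPatching p : Liu2002Thm8124Projective → PrincipalizationInChar p → EmbResCodimTwo p →
ProperModel.TwoModelPatching p` (stub S1, "Zariski's bad-stratum induction in trdeg `n`"),
Piltant's Axiom 4 `PrincipalizationInChar p` (stub S2) and the CJS-format embedded resolution in
codimension `≥ 2`, `EmbResCodimTwo p` (stub S3), all three quantified over ALL dimensions.

This file proves that S3, AS TYPED (ungraded in the ambient dimension), is summit-strength:

* `hasResolution_of_embResCodimTwo` — under `EmbResCodimTwo p`, every integral closed subscheme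
  of codimension `≥ 2` of a regular integral Noetherian separated `k`-scheme of finite type
  (`char k = p`) has a resolution: the CJS-format output is an embedded transform with centres
  over the subvariety ITSELF, and the generalised BGMW (3) ⇒ (4) lemma
  `hasResolution_of_isEmbeddedTransform_of_subset` (`Theorems/ValuativePatchingRelEmbeddedTransformSelf.lean`)
  reads a resolution off it (if a centre swallows the strict transform, the transform was already
  regular at that stage).
* `hasResolution_of_cossartJannsenSaito2020Embedded` — the same reading of the tree's named fact
  `CossartJannsenSaito2020Embedded` (its conclusion has exactly this shape for `dim X ≤ 2`):
  embedded surfaces in regular excellent schemes have resolutions (CJS Cor. 1.5).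
* `resolutionInChar_of_embResCodimTwo` — `EmbResCodimTwo p → ResolutionInChar p`: by the tree's
  reduction `resolutionInChar_iff_forall_immersion_projectiveSpace` it suffices to resolve an
  integral `X` immersed in `𝐏ⁿ_k`; re-embed `𝐏ⁿ_k ↪ 𝐏ⁿ⁺² _k` by two coordinate hyperplane
  embeddings (`ProjectiveSpace.skipMap`), so that `X` is closed in an open `U ⊆ 𝐏ⁿ⁺²_k` with
  `dim X + 2 ≤ n + 2 = dim U` (`IsInducing.topologicalKrullDim_le`,
  `Motives.topologicalKrullDim_eq_of_smoothOfRelativeDimension`), and apply the previous theorem.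
* `badStratumPatching_holds` — hence S1 holds outright (its third hypothesis already gives
  `ResolutionInChar p`, and resolution gives two-model patching,
  `ProperModel.twoModelPatching_of_resolutionInChar`); `stub_badStratumPatching` is the
  registered form.
* `patchingRel_of_embResCodimTwo`, `cyclicCovers_patchingRel_of_embResCodimTwo`,
  `resolutionOfSingularities_of_embResCodimTwo` — S3 alone gives the crux (LU, Axiom 4 and S1
  idle) and indeed the summit `ResolutionOfSingularities`.

So the line does not isolate new content: its composition closes the crux modulo S2 ∧ S3, S3 is
(at least) the summit in characteristic `p`, and S1 — the card's "hardest stub" — is a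
tautology relative to S3. (The card's INTENDED reading grades S3 by the ambient dimension —
`EmbResCodimTwo` for `dim Z ≤ n` resolves only `(n-2)`-folds — and in that reading S1's internal
termination lemma over intermediate points of bad subvarieties is, by the card's own account,
open mathematics.)

## References

* V. Cossart, U. Jannsen, S. Saito, *Desingularization: invariants and strategy*, LNM 2270
  (2020), Thm. 1.4. [CossartJannsenSaito2020]
* E. Bierstone, D. Grigoriev, P. Milman, J. Włodarczyk, arXiv:1206.3090, §3.3 (3) ⇒ (4).
  [BierstoneGrigorievMilmanWlodarczyk2011]
* J. Kollár, *Lectures on Resolution of Singularities* (2007), Thm. 3.36 from Cor. 3.22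
  (reduction to the quasi-projective integral case). [Kollar2007]
* O. Piltant, RACSAM 107 (2013), Prop. 5.1 (two-model patching). [Piltant2013]
-/

-- `Summit.<Summit>.<Sub>[.Theorems]` with `Sub = Summit` (single-conjunct summit, D-0017).
set_option linter.dupNamespace false

noncomputable section

namespace Summit.ResolutionOfSingularities.ResolutionOfSingularities.Theorems

open CategoryTheory CategoryTheory.Limits AlgebraicGeometry TopologicalSpace Topology
open Literature.AlgebraicGeometry.Resolution
open Scheme.IdealSheafData

universe u

/-! ## The line's two posited statements (verbatim from `Cruxes/PatchingRel/Ideator5Sketch.lean`) -/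

/-- OPEN CONJECTURE (as typed by the line; known for `dim Z ≤ 4`) — **Axiom 3 in transcendence
degree `n`: embedded resolution in codimension `≥ 2`, CJS format** (Cossart–Jannsen–Saito 2020,
Thm. 1.4 with `B = ∅`, conclusion shape of the tree's `CossartJannsenSaito2020Embedded.of_isClosed`):
for `k` of characteristic `p`, `Z` a regular integral Noetherian separated `k`-scheme of finite
type and `X ⊆ Z` closed with `dim X + 2 ≤ dim Z`, there is `π : Z₁ ⟶ Z` proper surjective, a
composite of blow-ups in regular centres over `X` (`IsEmbeddedTransform X X π X₁`), an
isomorphism over `Z ∖ X`, with `Z₁` regular, the iterated strict transform `X₁` regular (reduced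
structure on its closure), `B₁` a strict normal crossings divisor, `π⁻¹ X = X₁ ∪ B₁` and `X₁`
transversal with `B₁`. KNOWN for `dim Z ≤ 4` (CJS Thm. 1.4: then `dim X ≤ 2`); OPEN for
`dim Z ≥ 5` [status: open]. Verbatim the line's `EmbResCodimTwo` (crux
stmt-ResolutionOfSingularities-0642, card `bad-stratum-induction`); shown below to imply
`ResolutionInChar p` as it stands. [cite: CossartJannsenSaito2020, Thm. 1.4] -/
@[conjecture] def EmbResCodimTwo (p : ℕ) : Prop :=
  ∀ (k : Type u) [Field k] [CharP k p] (Z : Scheme.{u}) (f : Z ⟶ Spec (.of k)) [IsNoetherian Z],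
    IsSeparated f → LocallyOfFiniteType f → QuasiCompact f → IsIntegral Z → Scheme.IsRegular Z →
    ∀ (X : Set Z), IsClosed X → topologicalKrullDim X + 2 ≤ topologicalKrullDim Z →
      ∃ (Z₁ : Scheme.{u}) (π : Z₁ ⟶ Z) (X₁ B₁ : Set Z₁),
        IsEmbeddedTransform X X π X₁ ∧
        Scheme.IsRegular Z₁ ∧ IsProper π ∧ Function.Surjective π ∧
        (∃ U : Z.Opens, (U : Set Z) = Xᶜ ∧ IsIso (π ∣_ U)) ∧
        Scheme.IsRegular (vanishingIdeal ⟨closure X₁, isClosed_closure⟩).subscheme ∧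
        IsStrictNormalCrossingsDivisor Z₁ B₁ ∧
        π ⁻¹' X = X₁ ∪ B₁ ∧
        IsTransversalWith Z₁ X₁ B₁

/-- **Zariski's bad-stratum induction in transcendence degree `n`** — the line's stub S1,
verbatim (`Cruxes/PatchingRel/Ideator5Sketch.lean`): two-model patching of proper models
(`ProperModel.TwoModelPatching`, Piltant 2013 Prop. 5.1 in all transcendence degrees) from
Liu 8.1.24, Piltant's Axiom 4 `PrincipalizationInChar` and `EmbResCodimTwo`. PROVED below
(`badStratumPatching_holds`): the third hypothesis alone implies the conclusion.
[cite: Piltant2013, Prop. 5.1] -/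
def BadStratumPatching (p : ℕ) : Prop :=
  Liu2002Thm8124Projective.{u} → PrincipalizationInChar.{u} p → EmbResCodimTwo.{u} p →
    ProperModel.TwoModelPatching.{u} p

/-! ## `EmbResCodimTwo p` resolves closed subvarieties of codimension `≥ 2` of regular varieties -/

/-- **CJS-format embedded resolution in codimension `≥ 2` resolves the subvariety.** Under
`EmbResCodimTwo p`: for `k` of characteristic `p`, `Z` a regular integral Noetherian separated
`k`-scheme of finite type and `i : X ↪ Z` a closed immersion of an integral scheme with
`dim i(X) + 2 ≤ dim Z`, the scheme `X` has a resolution of singularities — the output of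
`EmbResCodimTwo` on the closed set `i(X)` is an embedded transform with centres over `i(X)` and
regular final strict transform, and `hasResolution_of_isEmbeddedTransform_of_subset` applies with
`T = i(X)`. [cite: BierstoneGrigorievMilmanWlodarczyk2011, §3.3 (3)⇒(4)]
[cite: CossartJannsenSaito2020, Thm. 1.4] -/
theorem hasResolution_of_embResCodimTwo {p : ℕ} (hE : EmbResCodimTwo.{u} p) {k : Type u}
    [Field k] [CharP k p] {Z X : Scheme.{u}} (f : Z ⟶ Spec (.of k)) [IsNoetherian Z]
    [IsSeparated f] [LocallyOfFiniteType f] [QuasiCompact f] [IsIntegral Z]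
    (hZ : Scheme.IsRegular Z) (i : X ⟶ Z) [IsClosedImmersion i] [IsIntegral X]
    (hdim : topologicalKrullDim (Set.range i) + 2 ≤ topologicalKrullDim Z) :
    Scheme.HasResolution X := by
  obtain ⟨Z₁, π, X₁, B₁, hET, -, -, -, -, hreg, -, -, -⟩ :=
    hE k Z f ‹_› ‹_› ‹_› ‹_› hZ (Set.range i) i.isClosedEmbedding.isClosed_range hdim
  exact hasResolution_of_isEmbeddedTransform_of_subset i subset_rfl hET hreg

/-- **The same mechanism on the tree's named fact** `CossartJannsenSaito2020Embedded` (CJS 2020,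
Thm. 1.4 with `B = ∅`, which has exactly the `EmbResCodimTwo` conclusion shape for `dim X ≤ 2` in
any regular excellent Noetherian ambient `Z`): an integral closed subscheme of dimension `≤ 2` of
a regular excellent Noetherian scheme has a resolution of singularities (CJS 2020, Cor. 1.5, for
such embedded schemes) — read off the embedded statement by
`hasResolution_of_isEmbeddedTransform_of_subset`. [cite: CossartJannsenSaito2020, Thm. 1.4 and Cor. 1.5] -/
theorem hasResolution_of_cossartJannsenSaito2020Embedded (h : CossartJannsenSaito2020Embedded.{u})
    {X Z : Scheme.{u}} (i : X ⟶ Z) [IsClosedImmersion i] [IsIntegral X] [IsNoetherian Z]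
    (hZ : Scheme.IsRegular Z) (hexc : Scheme.IsExcellent Z) (hdim : topologicalKrullDim X ≤ 2) :
    Scheme.HasResolution X := by
  obtain ⟨Z₁, π, X₁, B₁, hET, -, -, -, -, hreg, -, -, -⟩ := h X Z i hZ hexc hdim
  exact hasResolution_of_isEmbeddedTransform_of_subset i subset_rfl hET hreg

/-! ## `EmbResCodimTwo p → ResolutionInChar p` -/

/-- **The line's Axiom-3 hypothesis is summit-strength: `EmbResCodimTwo p → ResolutionInChar p`.**
By `resolutionInChar_iff_forall_immersion_projectiveSpace` it suffices to resolve every integral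
`X` with an immersion `ι : X → 𝐏ⁿ_k` (`char k = p`). Compose `ι` with two coordinate-hyperplane
embeddings `𝐏ⁿ_k ↪ 𝐏ⁿ⁺¹_k ↪ 𝐏ⁿ⁺²_k` (`ProjectiveSpace.skipMap`, closed immersions); the
composite immersion is a closed immersion into the open `U = coborderRange ⊆ 𝐏ⁿ⁺²_k`, which is
a regular integral Noetherian separated `k`-scheme of finite type with `dim U = n + 2`
(`Motives.topologicalKrullDim_eq_of_smoothOfRelativeDimension`), while `dim X ≤ dim 𝐏ⁿ_k = n`
(`IsInducing.topologicalKrullDim_le`); now apply `hasResolution_of_embResCodimTwo`.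
[cite: Kollar2007, Thm. 3.36 from Cor. 3.22] [cite: CossartJannsenSaito2020, Thm. 1.4] -/
theorem resolutionInChar_of_embResCodimTwo {p : ℕ} (hE : EmbResCodimTwo.{u} p) :
    ResolutionInChar.{u} p := by
  rw [resolutionInChar_iff_forall_immersion_projectiveSpace]
  intro k _ _ n X ι hι hX
  haveI := hι
  haveI := hX
  -- the ambient projective spaces
  let P : ℕ → Scheme.{u} := fun m => (Literature.AlgebraicGeometry.Motives.projectiveSpace m k).left
  let g : ∀ m : ℕ, P m ⟶ Spec (.of k) :=
    fun m => (Literature.AlgebraicGeometry.Motives.projectiveSpace m k).hom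
  -- re-embed `𝐏ⁿ ↪ 𝐏ⁿ⁺²`
  let s : P n ⟶ P (n + 2) :=
    (Literature.AlgebraicGeometry.Motives.ProjectiveSpace.skipMap (k := k) (n := n) 0).left ≫
      (Literature.AlgebraicGeometry.Motives.ProjectiveSpace.skipMap (k := k) (n := n + 1) 0).left
  haveI : IsClosedImmersion s := inferInstance
  let ι₂ : X ⟶ P (n + 2) := ι ≫ s
  haveI : IsImmersion ι₂ := inferInstance
  -- `X` is closed in the open `U ⊆ 𝐏ⁿ⁺²`
  let U : (P (n + 2)).Opens := ι₂.coborderRange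
  let i : X ⟶ (U : Scheme.{u}) := ι₂.liftCoborder
  haveI : IsClosedImmersion i := inferInstance
  -- the ambient `U`: regular, integral, Noetherian, separated of finite type over `k`
  obtain ⟨hs, hsep, hqc, hreg⟩ :=
    smooth_isSeparated_quasiCompact_isRegular_opens_projectiveSpace (k := k) (n + 2) U
  haveI := hs
  haveI := hsep
  haveI := hqc
  haveI : LocallyOfFiniteType (U.ι ≫ g (n + 2)) := inferInstance
  haveI : IsProper (g (n + 2)) := Literature.AlgebraicGeometry.Motives.isProper_projectiveSpace (n + 2) k
  haveI : IsLocallyNoetherian (P (n + 2)) := LocallyOfFiniteType.isLocallyNoetherian (g (n + 2))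
  haveI : CompactSpace (P (n + 2)) := QuasiCompact.compactSpace_of_compactSpace (g (n + 2))
  haveI : IsNoetherian (P (n + 2)) := {}
  haveI : IsIntegral (P (n + 2)) := isIntegral_projectiveSpace (n + 2) k
  haveI : Nonempty X := inferInstance
  haveI : Nonempty (U : Scheme.{u}) := ⟨i (Classical.arbitrary X)⟩
  haveI : IsIntegral (U : Scheme.{u}) := isIntegral_of_isOpenImmersion U.ι
  haveI : CompactSpace (U : Scheme.{u}) := QuasiCompact.compactSpace_of_compactSpace (U.ι ≫ g (n + 2))
  haveI : IsNoetherian (U : Scheme.{u}) := {}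
  -- dimensions: `dim U = n + 2`
  haveI : SmoothOfRelativeDimension (n + 2) (g (n + 2)) :=
    (Literature.AlgebraicGeometry.Motives.isSmoothProjective_projectiveSpace_holds k (n + 2))
      |>.smoothOfRelativeDimension
  haveI : SmoothOfRelativeDimension (0 + (n + 2)) (U.ι ≫ g (n + 2)) := inferInstance
  have hU : topologicalKrullDim (U : Scheme.{u}) = ((n + 2 : ℕ) : WithBot ℕ∞) := by
    have h := Literature.AlgebraicGeometry.Motives.topologicalKrullDim_eq_of_smoothOfRelativeDimension
      (U.ι ≫ g (n + 2)) (0 + (n + 2))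
    rwa [Nat.zero_add] at h
  -- `dim 𝐏ⁿ = n` and `dim i(X) = dim X ≤ dim 𝐏ⁿ`
  haveI : SmoothOfRelativeDimension n (g n) :=
    (Literature.AlgebraicGeometry.Motives.isSmoothProjective_projectiveSpace_holds k n)
      |>.smoothOfRelativeDimension
  haveI : Nonempty (P n) := ⟨ι (Classical.arbitrary X)⟩
  have hPn : topologicalKrullDim (P n) = (n : WithBot ℕ∞) :=
    Literature.AlgebraicGeometry.Motives.topologicalKrullDim_eq_of_smoothOfRelativeDimension (g n) n
  have hXle : topologicalKrullDim (Set.range i) ≤ (n : WithBot ℕ∞) := by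
    calc topologicalKrullDim (Set.range i) ≤ topologicalKrullDim X :=
          (i.isClosedEmbedding.isEmbedding.toHomeomorph).symm.isInducing.topologicalKrullDim_le
      _ ≤ topologicalKrullDim (P n) := ι.isEmbedding.isInducing.topologicalKrullDim_le
      _ = n := hPn
  have hdim : topologicalKrullDim (Set.range i) + 2 ≤ topologicalKrullDim (U : Scheme.{u}) := by
    rw [hU]
    calc topologicalKrullDim (Set.range i) + 2 ≤ (n : WithBot ℕ∞) + 2 := add_le_add hXle le_rfl
      _ = ((n + 2 : ℕ) : WithBot ℕ∞) := by push_cast; rfl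
  exact hasResolution_of_embResCodimTwo hE (U.ι ≫ g (n + 2)) hreg i hdim

/-! ## Consequences for the line -/

/-- **Stub S1 of the line holds outright**: `BadStratumPatching p` for every `p` — its third
hypothesis `EmbResCodimTwo p` gives `ResolutionInChar p` (`resolutionInChar_of_embResCodimTwo`),
and resolution of singularities gives two-model patching of proper models (resolve the join,
`ProperModel.twoModelPatching_of_resolutionInChar`); the hypotheses `Liu2002Thm8124Projective`
and `PrincipalizationInChar p` are not used. [folklore] -/
theorem badStratumPatching_holds (p : ℕ) : BadStratumPatching.{u} p :=
  fun _ _ hE => ProperModel.twoModelPatching_of_resolutionInChar (resolutionInChar_of_embResCodimTwo hE)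

/-- Registered form of stub S1 of line `Ideator5Sketch` (crux stmt-ResolutionOfSingularities-0642):
`∀ p prime, BadStratumPatching.{0} p`. [folklore] -/
theorem stub_badStratumPatching : ∀ p : ℕ, p.Prime → BadStratumPatching.{0} p :=
  fun p _ => badStratumPatching_holds p

/-- **The line collapses onto its stub S3**: `EmbResCodimTwo` in every prime characteristic
implies the crux `Valuative.PatchingRel` with the antecedent `LUrel_p`, Axiom 4 and S1 all idle.
[folklore] -/
theorem patchingRel_of_embResCodimTwo (hE : ∀ p : ℕ, p.Prime → EmbResCodimTwo.{0} p) :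
    Summit.ResolutionOfSingularities.ResolutionOfSingularities.Theses.Valuative.PatchingRel :=
  fun p hp _ => resolutionInChar_of_embResCodimTwo (hE p hp)

/-- The same for the shared copy of the crux on route `CyclicCovers` (definitionally equal).
[folklore] -/
theorem cyclicCovers_patchingRel_of_embResCodimTwo (hE : ∀ p : ℕ, p.Prime → EmbResCodimTwo.{0} p) :
    Summit.ResolutionOfSingularities.ResolutionOfSingularities.Theses.CyclicCovers.PatchingRel :=
  fun p hp _ => resolutionInChar_of_embResCodimTwo (hE p hp)

/-- **Indeed S3 is summit-strength**: `EmbResCodimTwo` in every prime characteristic implies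
the summit statement `ResolutionOfSingularities` itself. [folklore] -/
theorem resolutionOfSingularities_of_embResCodimTwo (hE : ∀ p : ℕ, p.Prime → EmbResCodimTwo.{0} p) :
    Literature.AlgebraicGeometry.Resolution.ResolutionOfSingularities :=
  fun p hp => resolutionInChar_of_embResCodimTwo (hE p hp)

end Summit.ResolutionOfSingularities.ResolutionOfSingularities.Theorems

end
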